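import Literature.MathematicalPhysics.QuantumManyBody.BoseEinsteinCondensation
import Literature.MathematicalPhysics.QuantumManyBody.OnsagerInequality
import HarnessLib

/-!
# Cube counting for finite point configurations in `ℝ³`

Topic `Literature/MathematicalPhysics/QuantumManyBody`; elementary combinatorics behind the
classical stability of pair potentials with a positive core and a shallow negative (or, here,
subtracted) tail — Ruelle's "stability from a positive core" argument
(*Statistical Mechanics* (1969) §3.2.5) in the form used for the dilute Bose gas
(cf. [LSSY2005] Ch. 2, and J. O. Lee, J. Stat. Phys. 134 (2009), Def. 2): for radii
`0 < r₁` and `R₀` there is a constant `K` such that for EVERY finite configuration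
`x₁, …, x_N ∈ ℝ³`

  `#{i < j : |xᵢ - xⱼ| ≤ R₀} ≤ K · (#{i < j : |xᵢ - xⱼ| < r₁} + N)`      (`pair_count_le`).

Proof: tile `ℝ³` by half-open cubes of side `r₁/2` (diameter `< r₁`), label each point by the
integer vector of its cube; two points at distance `≤ R₀` have labels differing by an element of
the finite box `D = [-K₀, K₀]³`, `K₀ = ⌈2R₀/r₁⌉`, and for any labelling `f` of a finite set by an
additive group the ordered pairs with `f j - f i ∈ D` number at most `2 #D` times the ordered
pairs with `f j = f i` (`sum_sum_ite_sub_mem_le`, fibrewise from `n(c) n(c') ≤ n(c)² + n(c')²`,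
`weighted_pair_count_le`); ordered pairs are compared with pairs `i < j` through the diagonal /
upper-triangle splitting `Coulomb.sum_sum_eq_diag_add_two_mul` of `OnsagerInequality.lean`.
Also recorded: the `ℝ≥0∞` bookkeeping `interaction_ofReal` for `BoseGas.interaction` of a
finite real profile.

Design: everything is stated with real-valued indicator sums `∑ i, ∑ j [with i < j], if … then 1
else 0` over `Fin N`, the form in which `BoseGas.interaction` unfolds; no measure theory.
Not here: the analytic (pointwise) half of a stability estimate, which depends on the potential.

## References

* D. Ruelle, *Statistical Mechanics: Rigorous Results* (1969), §3.2.
* [LSSY2005] E. H. Lieb, R. Seiringer, J. P. Solovej, J. Yngvason, *The Mathematics of the Bose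
  Gas and its Condensation* (2005), Ch. 2.
* [Lee2009] J. O. Lee, Ground state energy of dilute Bose gas in small negative potential case,
  J. Stat. Phys. 134 (2009), Def. 2 and Thm. 7.
-/

noncomputable section

open scoped ENNReal BigOperators

namespace Literature.MathematicalPhysics.QuantumManyBody.BoseGas

/-! ## Counting pairs through the fibres of a labelling -/

/-- Fibrewise summation: `∑ᵢ g(f i) = ∑_{c ∈ im f} #f⁻¹(c) · g(c)`. [folklore] -/
theorem sum_fiber {ι G : Type*} [Fintype ι] [DecidableEq G] (f : ι → G) (g : G → ℝ) :
    ∑ i, g (f i) = ∑ c ∈ Finset.univ.image f,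
      ((Finset.univ.filter fun i => f i = c).card : ℝ) * g c := by
  rw [Finset.sum_comp]
  exact Finset.sum_congr rfl fun c _ => nsmul_eq_mul _ _

/-- Weighted near-pair count: for real weights `n` on a finite set `Q` of an additive group
and a finite set `D` of admissible differences,
`∑_{c,c' ∈ Q, c'-c ∈ D} n(c) n(c') ≤ 2 #D ∑_{c ∈ Q} n(c)²` (from `n(c)n(c') ≤ n(c)² + n(c')²` and
the injectivity of `c' ↦ c' - c`). [folklore] -/
theorem weighted_pair_count_le {G : Type*} [AddCommGroup G] [DecidableEq G]
    (Q D : Finset G) (n : G → ℝ) :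
    (∑ c ∈ Q, ∑ c' ∈ Q, (if c' - c ∈ D then (1 : ℝ) else 0) * (n c * n c'))
      ≤ 2 * D.card * ∑ c ∈ Q, n c ^ 2 := by
  have hχ0 : ∀ c c' : G, (0 : ℝ) ≤ if c' - c ∈ D then 1 else 0 := fun c c' => by
    split_ifs <;> norm_num
  have hrow : ∀ c ∈ Q, (∑ c' ∈ Q, if c' - c ∈ D then (1 : ℝ) else 0) ≤ D.card := by
    intro c _
    rw [Finset.sum_boole, Nat.cast_le]
    refine Finset.card_le_card_of_injOn (fun c' => c' - c) ?_ ?_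
    · intro c' hc'
      exact (Finset.mem_filter.1 (Finset.mem_coe.1 hc')).2
    · intro a _ b _ h
      exact sub_left_inj.1 h
  have hcol : ∀ c' ∈ Q, (∑ c ∈ Q, if c' - c ∈ D then (1 : ℝ) else 0) ≤ D.card := by
    intro c' _
    rw [Finset.sum_boole, Nat.cast_le]
    refine Finset.card_le_card_of_injOn (fun c => c' - c) ?_ ?_
    · intro c hc
      exact (Finset.mem_filter.1 (Finset.mem_coe.1 hc)).2
    · intro a _ b _ h
      exact sub_right_inj.1 h
  have hsplit : ∀ c ∈ Q, (∑ c' ∈ Q, (if c' - c ∈ D then (1 : ℝ) else 0) * (n c ^ 2 + n c' ^ 2))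
      = n c ^ 2 * (∑ c' ∈ Q, if c' - c ∈ D then (1 : ℝ) else 0)
        + ∑ c' ∈ Q, (if c' - c ∈ D then (1 : ℝ) else 0) * n c' ^ 2 := by
    intro c _
    rw [Finset.mul_sum, ← Finset.sum_add_distrib]
    exact Finset.sum_congr rfl fun c' _ => by ring
  calc (∑ c ∈ Q, ∑ c' ∈ Q, (if c' - c ∈ D then (1 : ℝ) else 0) * (n c * n c'))
      ≤ ∑ c ∈ Q, ∑ c' ∈ Q, (if c' - c ∈ D then (1 : ℝ) else 0) * (n c ^ 2 + n c' ^ 2) :=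
        Finset.sum_le_sum fun c _ => Finset.sum_le_sum fun c' _ => by
          refine mul_le_mul_of_nonneg_left ?_ (hχ0 c c')
          nlinarith [sq_nonneg (n c - n c'), sq_nonneg (n c), sq_nonneg (n c')]
    _ = ∑ c ∈ Q, n c ^ 2 * (∑ c' ∈ Q, if c' - c ∈ D then (1 : ℝ) else 0)
        + ∑ c' ∈ Q, n c' ^ 2 * (∑ c ∈ Q, if c' - c ∈ D then (1 : ℝ) else 0) := by
        rw [Finset.sum_congr rfl hsplit, Finset.sum_add_distrib, Finset.sum_comm]
        congr 1
        refine Finset.sum_congr rfl fun c' _ => ?_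
        rw [Finset.mul_sum]
        exact Finset.sum_congr rfl fun c _ => mul_comm _ _
    _ ≤ ∑ c ∈ Q, n c ^ 2 * (D.card : ℝ) + ∑ c' ∈ Q, n c' ^ 2 * (D.card : ℝ) := by
        gcongr with c hc c' hc'
        · exact hrow c hc
        · exact hcol c' hc'
    _ = 2 * D.card * ∑ c ∈ Q, n c ^ 2 := by
        rw [← Finset.sum_mul]
        ring

/-- Ordered near pairs versus ordered coincident pairs of a labelling `f : ι → G`:
`#{(i,j) : f j - f i ∈ D} ≤ 2 #D · #{(i,j) : f j = f i}` (fibrewise, by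
`weighted_pair_count_le` with the fibre cardinalities as weights). [folklore] -/
theorem sum_sum_ite_sub_mem_le {ι G : Type*} [Fintype ι] [AddCommGroup G] [DecidableEq G]
    (f : ι → G) (D : Finset G) :
    (∑ i, ∑ j, if f j - f i ∈ D then (1 : ℝ) else 0)
      ≤ 2 * D.card * ∑ i, ∑ j, if f j = f i then (1 : ℝ) else 0 := by
  have hL : (∑ i, ∑ j, if f j - f i ∈ D then (1 : ℝ) else 0)
      = ∑ c ∈ Finset.univ.image f, ∑ c' ∈ Finset.univ.image f,
          (if c' - c ∈ D then (1 : ℝ) else 0) *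
            (((Finset.univ.filter fun i => f i = c).card : ℝ) *
              ((Finset.univ.filter fun i => f i = c').card : ℝ)) := by
    calc (∑ i, ∑ j, if f j - f i ∈ D then (1 : ℝ) else 0)
        = ∑ i, ∑ c' ∈ Finset.univ.image f,
            ((Finset.univ.filter fun j => f j = c').card : ℝ) *
              (if c' - f i ∈ D then (1 : ℝ) else 0) :=
          Finset.sum_congr rfl fun i _ => sum_fiber f (fun c' => if c' - f i ∈ D then (1 : ℝ) else 0)
      _ = ∑ c ∈ Finset.univ.image f, ((Finset.univ.filter fun i => f i = c).card : ℝ) *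
            ∑ c' ∈ Finset.univ.image f,
              ((Finset.univ.filter fun j => f j = c').card : ℝ) *
                (if c' - c ∈ D then (1 : ℝ) else 0) :=
          sum_fiber f (fun c => ∑ c' ∈ Finset.univ.image f,
            ((Finset.univ.filter fun j => f j = c').card : ℝ) *
              (if c' - c ∈ D then (1 : ℝ) else 0))
      _ = _ := by
          refine Finset.sum_congr rfl fun c _ => ?_
          rw [Finset.mul_sum]
          exact Finset.sum_congr rfl fun c' _ => by ring
  have hR : (∑ i, ∑ j, if f j = f i then (1 : ℝ) else 0)
      = ∑ c ∈ Finset.univ.image f, ((Finset.univ.filter fun i => f i = c).card : ℝ) ^ 2 := by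
    calc (∑ i, ∑ j, if f j = f i then (1 : ℝ) else 0)
        = ∑ i, ((Finset.univ.filter fun j => f j = f i).card : ℝ) :=
          Finset.sum_congr rfl fun i _ => Finset.sum_boole _ _
      _ = ∑ c ∈ Finset.univ.image f, ((Finset.univ.filter fun i => f i = c).card : ℝ) *
            ((Finset.univ.filter fun j => f j = c).card : ℝ) :=
          sum_fiber f (fun c => ((Finset.univ.filter fun j => f j = c).card : ℝ))
      _ = _ := Finset.sum_congr rfl fun c _ => by ring
  rw [hL, hR]
  exact weighted_pair_count_le _ _ _

/-! ## Cube counting in `ℝ³` -/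

/-- **Cube counting.** For `0 < r₁` and any `R₀` there is `K ≥ 0` such that for every finite
configuration of points of `ℝ³` the number of pairs `i < j` at distance `≤ R₀` is at most
`K` times (the number of pairs `i < j` at distance `< r₁` plus the number of points): tile `ℝ³` by
half-open cubes of side `r₁/2` (diameter `< r₁`); two points at distance `≤ R₀` lie in cubes whose
integer labels differ by at most `K₀ = ⌈2R₀/r₁⌉` in each coordinate, and the fibrewise count
`sum_sum_ite_sub_mem_le` bounds such ordered pairs by `2(2K₀+1)³` times the ordered pairs in a
common cube. [folklore] -/
theorem pair_count_le (r₁ R₀ : ℝ) (hr₁ : 0 < r₁) :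
    ∃ K : ℝ, 0 ≤ K ∧ ∀ (N : ℕ) (X : Config N),
      (∑ i, ∑ j with i < j, if dist (X i) (X j) ≤ R₀ then (1 : ℝ) else 0)
        ≤ K * ((∑ i, ∑ j with i < j, if dist (X i) (X j) < r₁ then (1 : ℝ) else 0) + N) := by
  set s : ℝ := r₁ / 2 with hs
  have hs0 : 0 < s := by positivity
  set K₀ : ℤ := ⌈R₀ / s⌉ with hK₀
  set D : Finset (Fin 3 → ℤ) := Fintype.piFinset fun _ => Finset.Icc (-K₀) K₀ with hD
  refine ⟨4 * D.card, by positivity, fun N X => ?_⟩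
  obtain ⟨idx, hidx⟩ : ∃ idx : Fin N → Fin 3 → ℤ, ∀ i a, idx i a = ⌊X i a / s⌋ :=
    ⟨fun i a => ⌊X i a / s⌋, fun _ _ => rfl⟩
  -- two points in a common cube are at distance `< r₁`
  have hsame : ∀ i j, idx j = idx i → dist (X i) (X j) < r₁ := by
    intro i j hij
    have hcoord : ∀ a, dist (X i a) (X j a) ≤ s := by
      intro a
      have ha : ⌊X i a / s⌋ = ⌊X j a / s⌋ := by rw [← hidx, ← hidx, hij]
      have h := Int.abs_sub_lt_one_of_floor_eq_floor ha
      rw [← sub_div, abs_div, abs_of_pos hs0, div_lt_one hs0] at h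
      rw [Real.dist_eq]
      exact h.le
    have hsq : dist (X i) (X j) ^ 2 < r₁ ^ 2 := by
      rw [EuclideanSpace.dist_sq_eq]
      calc ∑ a, dist (X i a) (X j a) ^ 2 ≤ ∑ _a : Fin 3, s ^ 2 :=
            Finset.sum_le_sum fun a _ => pow_le_pow_left₀ dist_nonneg (hcoord a) 2
        _ = 3 * s ^ 2 := by simp
        _ < r₁ ^ 2 := by rw [hs]; nlinarith
    exact lt_of_pow_lt_pow_left₀ 2 hr₁.le hsq
  -- two points at distance `≤ R₀` have labels differing by an element of `D`
  have hnear : ∀ i j, dist (X i) (X j) ≤ R₀ → idx j - idx i ∈ D := by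
    intro i j hij
    rw [hD, Fintype.mem_piFinset]
    intro a
    rw [Finset.mem_Icc, Pi.sub_apply, hidx, hidx]
    have ha : |X i a - X j a| ≤ R₀ := by
      rw [← Real.dist_eq]
      exact (PiLp.dist_apply_le (X i) (X j) a).trans hij
    have hq : |X i a / s - X j a / s| ≤ R₀ / s := by
      rw [← sub_div, abs_div, abs_of_pos hs0]
      exact div_le_div_of_nonneg_right ha hs0.le
    obtain ⟨hq1, hq2⟩ := abs_le.1 hq
    have hf1 := Int.floor_le (X i a / s)
    have hf1' := Int.lt_floor_add_one (X i a / s)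
    have hf2 := Int.floor_le (X j a / s)
    have hf2' := Int.lt_floor_add_one (X j a / s)
    have hc := Int.le_ceil (R₀ / s)
    have h1 : ((⌊X i a / s⌋ - ⌊X j a / s⌋ : ℤ) : ℝ) < (K₀ : ℝ) + 1 := by
      push_cast; linarith
    have h2 : ((⌊X j a / s⌋ - ⌊X i a / s⌋ : ℤ) : ℝ) < (K₀ : ℝ) + 1 := by
      push_cast; linarith
    have h1' : ⌊X i a / s⌋ - ⌊X j a / s⌋ < K₀ + 1 := by exact_mod_cast h1
    have h2' : ⌊X j a / s⌋ - ⌊X i a / s⌋ < K₀ + 1 := by exact_mod_cast h2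
    constructor <;> omega
  -- the chain of counts
  have hPc : (∑ i, ∑ j, if dist (X i) (X j) < r₁ then (1 : ℝ) else 0)
      = N + 2 * ∑ i, ∑ j with i < j, if dist (X i) (X j) < r₁ then (1 : ℝ) else 0 := by
    rw [Coulomb.sum_sum_eq_diag_add_two_mul (fun i j => if dist (X i) (X j) < r₁ then (1 : ℝ) else 0)
      (fun i j => by rw [dist_comm])]
    simp [hr₁]
  have hnonneg : 0 ≤ ∑ i, ∑ j with i < j, if dist (X i) (X j) < r₁ then (1 : ℝ) else 0 :=
    Finset.sum_nonneg fun i _ => Finset.sum_nonneg fun j _ => by split_ifs <;> norm_num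
  calc (∑ i, ∑ j with i < j, if dist (X i) (X j) ≤ R₀ then (1 : ℝ) else 0)
      ≤ ∑ i, ∑ j with i < j, if idx j - idx i ∈ D then (1 : ℝ) else 0 := by
        refine Finset.sum_le_sum fun i _ => Finset.sum_le_sum fun j _ => ?_
        by_cases h : dist (X i) (X j) ≤ R₀
        · rw [if_pos h, if_pos (hnear i j h)]
        · rw [if_neg h]
          split_ifs <;> norm_num
    _ ≤ ∑ i, ∑ j, if idx j - idx i ∈ D then (1 : ℝ) else 0 :=
        Finset.sum_le_sum fun i _ => Finset.sum_le_sum_of_subset_of_nonneg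
          (Finset.filter_subset _ _) fun j _ _ => by split_ifs <;> norm_num
    _ ≤ 2 * D.card * ∑ i, ∑ j, if idx j = idx i then (1 : ℝ) else 0 :=
        sum_sum_ite_sub_mem_le idx D
    _ ≤ 2 * D.card * ∑ i, ∑ j, if dist (X i) (X j) < r₁ then (1 : ℝ) else 0 := by
        refine mul_le_mul_of_nonneg_left
          (Finset.sum_le_sum fun i _ => Finset.sum_le_sum fun j _ => ?_) (by positivity)
        by_cases h : idx j = idx i
        · rw [if_pos h, if_pos (hsame i j h)]
        · rw [if_neg h]
          split_ifs <;> norm_num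
    _ = 2 * D.card * (N + 2 * ∑ i, ∑ j with i < j,
          if dist (X i) (X j) < r₁ then (1 : ℝ) else 0) := by rw [hPc]
    _ ≤ 4 * D.card * ((∑ i, ∑ j with i < j, if dist (X i) (X j) < r₁ then (1 : ℝ) else 0)
          + N) := by
        nlinarith [hnonneg, (Nat.cast_nonneg N : (0 : ℝ) ≤ N),
          (Nat.cast_nonneg D.card : (0 : ℝ) ≤ D.card)]

/-! ## `ℝ≥0∞` bookkeeping for `interaction` -/

/-- The interaction of a finite real profile is `ofReal` of the real pair sum. [folklore] -/
theorem interaction_ofReal {N : ℕ} (w : ℝ → ℝ) (hw : ∀ r, 0 ≤ w r) (X : Config N) :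
    interaction (fun r => ENNReal.ofReal (w r)) X
      = ENNReal.ofReal (∑ i, ∑ j with i < j, w (dist (X i) (X j))) := by
  unfold interaction
  rw [ENNReal.ofReal_sum_of_nonneg fun i _ => Finset.sum_nonneg fun j _ => hw _]
  exact Finset.sum_congr rfl fun i _ => (ENNReal.ofReal_sum_of_nonneg fun j _ => hw _).symm

end Literature.MathematicalPhysics.QuantumManyBody.BoseGas
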